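import Literature.MathematicalPhysics.QuantumFieldTheory.Balaban1983to89.B14Eq349WardReduction
import Literature.MathematicalPhysics.QuantumFieldTheory.Balaban1983to89.B14Thm2Assembly

/-!
# `Balaban1983to89.B14.Claim283RBound` — [Balaban1988Convergent] p. 283, the 𝐑-side of the proof of Theorem 2:
# «we stop at the identity (3.49) … all the terms on the right-hand side can be bounded by
# O(1)(LʲL⁻ⁿ)⁴g_j^{κ₀}exp(−κd_j(X))» — the PER-DOMAIN BOUND derived at the abstract-tower level of
# `…B14.Eq349WardReduction.eq349_abstract`, and its summation to the per-point term of (2.44)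

statement-level skeleton of published theorems with citation tags; proofs where landed; nothing here is a
claim about the Yang–Mills mass gap

PDF held: `paper:balaban1988-cmp119-convergent-renormalization` (journal page = PDF page + 242); p. 283 READ AS AN IMAGE
on the x2 render `…-p041-x2.png` of `run/shared/lean/pub/pub-balaban/b2b-balaban-ref1/pages/1988-cmp119-convergent-
renormalization/` by the author of this file (2026-08-22, render-verification sweep T24 of `lit-balaban-r11/ROWS-B14.md`).

CITATION HEADER (lean-in-tree rule).  Source: T. Bałaban, *Convergent renormalization expansions for lattice gauge
theories*, Commun. Math. Phys. **119**, 243–285 (1988) [Balaban1988Convergent] (cell paper B14 = "[III]"), p. 283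
(last paragraph of the proof of Theorem 2), with (2.31) p. 260 and (2.44) p. 263; [II] = T. Bałaban, Commun. Math. Phys.
**116** (1988) 1–22 [Balaban1988RG2Cluster], (1.26) p. 8.  Mega-formalization `lit-balaban` (HOME
`run/shared/lean/pub/lit-balaban/`), reader/typer unit `lit-balaban-r11` (generation 10), SKELETON rows **B14.Claim@283R**
(decls of record so far: `B14Sect3.Rep244`, `ineq244_of_rep244` — the per-point summation —, `B14.Thm2Assembly.
perPointR_of_domainBound` — per-domain bound ⇒ per-point term via (1.26) —; the PER-DOMAIN BOUND ITSELF was a hypothesis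
`hr` there) and **B14.Thm2** (status cell, ROWS-B14 v1.56: «STILL NOT theorems of the tree … the 𝐑-side per-domain bound
of p.283»).  Imports the row's own `…B14Eq349WardReduction` (r11 gen 9: `eq349_abstract`, `remainder349_norm_le`,
`norm_kappa_le`) and `…B14Thm2Assembly` (r11 gen 5: `perPointR_of_domainBound`; through it `…B12TreeDecay`); uses them BY
NAME; modifies nothing; NO `def`, no new `Prop`, no named fact (D-0026: theorems only).

THE PRINTED TEXT (verbatim, p. 283 [PDF 41]).  *"The inequality (2.44) for the functions 𝐑^{(j)} can be proved in an
almost identical way. We analyze these functions as above, but we stop at the identity (3.49), where 𝐄^{(2)}(X, x, y, z)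
is replaced by 𝐑^{(2)}(X, x, y), and z is an arbitrary point from X. Now all the terms on the right-hand side can be
bounded by O(1)(LʲL⁻ⁿ)⁴g_j^{κ₀} exp(−κd_j(X)), and this yields the inequality (2.44). The proof of Theorem 2 is
completed."*  With (2.31) p. 260: *"|𝐑^{(j)}(X, (𝐔, 𝐉))| ≤ g_j^{κ₀} exp(−κd_j(X))"* (the inductive bound on the analyticity
space, from which the sizes of the functional derivatives 𝐑^{(n)} follow by Cauchy estimates, as (3.48)/(I.1.18) for 𝐄; v1 wrote «(II.1.18)» here — a slip for [III] p. 259's «(I.1.18)» = [I] (1.18)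
p. 263, CITELOC DELTA #11 of the cell `pub-balaban` summit-lit1 gen 44);
p. 280/281: the field scalings of [I] (4.16)–(4.18) «in the L⁻ⁿ-scale» and *"(the irrelevant terms) … can be bounded by
O((LʲL⁻ⁿ)^{5−β}) exp(−κd_j(X))"*; (2.44) p. 263: *"|Σ_{X∈𝐃_j, X⊂Λ_j, X∩Ω≠∅}[𝐑^{(j)}(X, U_k) − 𝐑^{(j)}(X, 1)]| ≤ R₁g_j^{κ₀}
Σ_{n=j}^{k}|Γ_n∩Ω|"*.

THE MATHEMATICS (print's «almost identical way», made explicit at the level of `eq349_abstract`).  For the towers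
`R1, …, R4` of 𝐑^{(j)}(X, ·) at `B = 0` (gauge invariant by the inductive property (iii), hence satisfying (I.4.14),
(I.4.15)₁,₂,₃ exactly as 𝐄 does) the identity (3.49) reads `Σ_{n=1}^{4}(1/n!)⟨R^{(n)}, ⊗ⁿB⟩ = ½⟨R2, ℓ + ½i[λ_z, B(z)],
ℓ + ½i[λ_z, B(z)]⟩ + (R₁ + ⋯ + R₁₄)`.  With the tower sizes `‖Rn(u₁,…,u_n)‖ ≤ e_n∏‖u_i‖`, the bracket size `b`, and the
field scalings `‖B(z)‖, ‖λ_z‖ ≤ aσ`, `‖B(·,z)‖ ≤ aσ²`, `‖B − B(z) − B(·,z)‖ ≤ aσ²τ`, `σ = LʲL⁻ⁿ ≤ τ ≤ 1`: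
(§1) the MAIN term is marginal, `≤ ½e₂(a + ½ba²)²·σ⁴` — for 𝐑 it is NOT renormalized («For this term we perform the
vacuum energy renormalization only», p. 259), it is simply small by `e₂ = O(1)g_j^{κ₀}e^{−κd_j(X)}`; (§2) hence the whole
right-hand side of (3.49) is `≤ (½e₂(a + ½ba²)² + K(e,a,b))·σ⁴` (`K` = the polynomial of `remainder349_norm_le`, using
`τ ≤ 1`), for abstract towers under the WT hypotheses (`taylor4_norm_le`) and for ANY expression equal to that right-hand
side (`rhs349_norm_le` — e.g. the chart sums of `eq349_chart_of_isSemisimple`); (§3) adding a fifth-order Taylor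
remainder letter `‖D − Σ_{n≤4}(1/n!)⟨R^{(n)},⊗ⁿB⟩‖ ≤ e₅‖B‖⁵` (print: (I.3.34)/(I.3.54), the tree's
`…B14.Eq349Remainder`) and `‖B‖ ≤ 3aσ`: `‖D‖ ≤ (½e₂(a+½ba²)² + K + 243e₅a⁵)·σ⁴` (`diff_norm_le`); (§4) with the sizes
proportional to one number, `e_n ≤ k_n·E` — print's `E = g_j^{κ₀}exp(−κd_j(X))` up to the Cauchy radii — this is
`‖D‖ ≤ C(a,b,k)·σ⁴·E`, i.e. VERBATIM «bounded by O(1)(LʲL⁻ⁿ)⁴g_j^{κ₀}exp(−κd_j(X))» with `O(1) = C(a,b,k)` EXPLICIT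
(`diff_norm_le_printed`, `diff_norm_le_coupling`); (§5) in the chart `B ↦ 𝓡(exp ρB)` of a gauge-invariant `C⁴`
functional with semisimple charge algebra the Ward–Takahashi hypotheses are discharged by name
(`taylor4_chart_norm_le_of_isSemisimple`, via `eq349_chart_of_isSemisimple`); (§6) «this yields the inequality (2.44)»:
summing over the domains
above the cube of `z` by (1.26) of [II] (`B14.Thm2Assembly.perPointR_of_domainBound`) gives the per-point term
`≤ C·K₀·σ⁴·g_j^{κ₀}` of `B14Sect3.Rep244` (`perPointR_of_eq349`).  MODEL NOTES: (M1) as in `…B14.Eq349WardReduction`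
(finite index types, sup norms, `c = ∂λ_z` for the given `λ_z`); (M2) `e_n`, `b`, `a`, `k_n`, `E` are LETTERS — for
Bałaban's 𝐑^{(j)}(X, ·) they come from (2.31) by Cauchy estimates on the analyticity space (2.34)–(2.39), not done here
(the row's «one-carrier gluing» item); (M3) print's exponent is exactly 4 (no `β`): the main term is not subtracted.

## References
* [Balaban1988Convergent] T. Bałaban, Commun. Math. Phys. 119 (1988) 243–285, p.283; (2.31) p.260; (2.44) p.263;
  (3.49) p.280; p.281.
* [Balaban1988RG2Cluster] T. Bałaban, Commun. Math. Phys. 116 (1988) 1–22 ([II]: (1.26) p.8).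
* [Balaban1987RG1] T. Bałaban, Commun. Math. Phys. 109 (1987) 249–301 ([I]: (4.14)–(4.18) pp.284–285).
-/

namespace Literature.MathematicalPhysics.QuantumFieldTheory.Balaban1983to89.B14.Claim283RBound

open Literature.MathematicalPhysics.QuantumFieldTheory.Balaban1983to89
open Literature.MathematicalPhysics.QuantumFieldTheory.Balaban1983to89.B14.Eq349WardReduction

/-! ## §1. The main term of (3.49) is marginal: `‖½⟨R2, ℓ + ½m, ℓ + ½m⟩‖ ≤ ½e₂(a + ½ba²)²σ⁴` -/

section Towers

variable {Λ T : Type*} [Fintype Λ] [Fintype T] {V : Type*} [NormedAddCommGroup V] [NormedSpace ℝ V]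
  {F : Type*} [NormedAddCommGroup F] [NormedSpace ℝ F]

omit [NormedSpace ℝ V] in
/-- A component of a bond field is bounded by the field's sup norm. [folklore] -/
private theorem norm_apply₂_le (u : Λ → T → V) (ν : Λ) (y : T) : ‖u ν y‖ ≤ ‖u‖ :=
  (norm_le_pi_norm (u ν) y).trans (norm_le_pi_norm u ν)

/-- `‖(i[λ_z(y), c_ν(y)])_{ν,y}‖ ≤ b‖λ_z‖‖c‖` for a bracket with `‖i[x, y]‖ ≤ b‖x‖‖y‖` (sup norms). [folklore] -/
private theorem norm_mField_le (br : V →ₗ[ℝ] V →ₗ[ℝ] V) {b : ℝ} (hb0 : 0 ≤ b)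
    (hb : ∀ x y : V, ‖br x y‖ ≤ b * ‖x‖ * ‖y‖) (p : T → V) (u : Λ → T → V) :
    ‖(fun ν y => br (p y) (u ν y))‖ ≤ b * ‖p‖ * ‖u‖ := by
  have hM : 0 ≤ b * ‖p‖ * ‖u‖ := mul_nonneg (mul_nonneg hb0 (norm_nonneg _)) (norm_nonneg _)
  refine (pi_norm_le_iff_of_nonneg hM).2 fun ν => (pi_norm_le_iff_of_nonneg hM).2 fun y => (hb _ _).trans ?_
  exact mul_le_mul (mul_le_mul_of_nonneg_left (norm_le_pi_norm p y) hb0) (norm_apply₂_le u ν y)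
    (norm_nonneg _) (mul_nonneg hb0 (norm_nonneg _))

/-- **The main (marginal) term of (3.49) for 𝐑**: `‖½⟨R2, ℓ + ½i[λ_z,B(z)], ℓ + ½i[λ_z,B(z)]⟩‖ ≤ ½e₂(a + ½ba²)²·σ⁴`
under `‖R2 u v‖ ≤ e₂‖u‖‖v‖`, `‖i[x,y]‖ ≤ b‖x‖‖y‖`, `‖B(z)‖, ‖λ_z‖ ≤ aσ`, `‖B(·,z)‖ ≤ aσ²` — «For this term we perform the
vacuum energy renormalization only» (p. 259): no coupling counterterm is subtracted on the 𝐑-side, the main term is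
simply of order `σ⁴` times the size `e₂` of the tower. [cite: Balaban1988Convergent, p.283] -/
theorem main349_norm_le (E2 : (Λ → T → V) →L[ℝ] (Λ → T → V) →L[ℝ] F) {e₂ : ℝ} (he₂ : 0 ≤ e₂)
    (hE2 : ∀ u v, ‖E2 u v‖ ≤ e₂ * ‖u‖ * ‖v‖) (br : V →ₗ[ℝ] V →ₗ[ℝ] V) {b : ℝ} (hb0 : 0 ≤ b)
    (hb : ∀ x y : V, ‖br x y‖ ≤ b * ‖x‖ * ‖y‖) (lam : T → V) (c ℓ : Λ → T → V) {a σ : ℝ} (ha : 0 ≤ a)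
    (hσ0 : 0 ≤ σ) (hc : ‖c‖ ≤ a * σ) (hlam : ‖lam‖ ≤ a * σ) (hℓ : ‖ℓ‖ ≤ a * σ ^ 2) :
    ‖(2 : ℝ)⁻¹ • E2 (ℓ + (2 : ℝ)⁻¹ • fun ν y => br (lam y) (c ν y)) (ℓ + (2 : ℝ)⁻¹ • fun ν y => br (lam y) (c ν y))‖
      ≤ (2 : ℝ)⁻¹ * e₂ * (a + (2 : ℝ)⁻¹ * b * a ^ 2) ^ 2 * σ ^ 4 := by
  set w : Λ → T → V := ℓ + (2 : ℝ)⁻¹ • fun ν y => br (lam y) (c ν y) with hw_def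
  have hm : ‖(fun ν y => br (lam y) (c ν y))‖ ≤ b * a ^ 2 * σ ^ 2 := by
    refine (norm_mField_le br hb0 hb lam c).trans ?_
    have : b * ‖lam‖ * ‖c‖ ≤ b * (a * σ) * (a * σ) :=
      mul_le_mul (mul_le_mul_of_nonneg_left hlam hb0) hc (norm_nonneg _) (mul_nonneg hb0 (by positivity))
    calc b * ‖lam‖ * ‖c‖ ≤ b * (a * σ) * (a * σ) := this
      _ = b * a ^ 2 * σ ^ 2 := by ring
  have hw : ‖w‖ ≤ (a + (2 : ℝ)⁻¹ * b * a ^ 2) * σ ^ 2 := by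
    calc ‖w‖ ≤ ‖ℓ‖ + ‖(2 : ℝ)⁻¹ • fun ν y => br (lam y) (c ν y)‖ := norm_add_le _ _
      _ = ‖ℓ‖ + (2 : ℝ)⁻¹ * ‖(fun ν y => br (lam y) (c ν y))‖ := by
          rw [norm_smul, norm_inv, Real.norm_ofNat]
      _ ≤ a * σ ^ 2 + (2 : ℝ)⁻¹ * (b * a ^ 2 * σ ^ 2) := add_le_add hℓ (by linarith)
      _ = (a + (2 : ℝ)⁻¹ * b * a ^ 2) * σ ^ 2 := by ring
  have hA : 0 ≤ a + (2 : ℝ)⁻¹ * b * a ^ 2 := by positivity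
  calc ‖(2 : ℝ)⁻¹ • E2 w w‖ = (2 : ℝ)⁻¹ * ‖E2 w w‖ := by rw [norm_smul, norm_inv, Real.norm_ofNat]
    _ ≤ (2 : ℝ)⁻¹ * (e₂ * ‖w‖ * ‖w‖) := mul_le_mul_of_nonneg_left (hE2 w w) (by norm_num)
    _ ≤ (2 : ℝ)⁻¹ * (e₂ * ((a + (2 : ℝ)⁻¹ * b * a ^ 2) * σ ^ 2) * ((a + (2 : ℝ)⁻¹ * b * a ^ 2) * σ ^ 2)) := by
        gcongr
    _ = (2 : ℝ)⁻¹ * e₂ * (a + (2 : ℝ)⁻¹ * b * a ^ 2) ^ 2 * σ ^ 4 := by ring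

/-! ## §2. The whole right-hand side of (3.49) is `O(σ⁴)`: main term + the fourteen irrelevant terms -/

-- (the quadruply nested operator space over the iterated `Pi` type: one more level of pending instance synthesis)
set_option maxSynthPendingDepth 3 in
/-- **«all the terms on the right-hand side can be bounded»** — for ANY expression `S` equal to the right-hand side of
(3.49) (main term + the fourteen explicit irrelevant terms of `eq349_abstract`; e.g. the left-hand side of (3.49) for
abstract towers under the Ward–Takahashi hypotheses, or the chart sums of `eq349_chart_of_isSemisimple`):
`‖S‖ ≤ (½e₂(a + ½ba²)² + K(e,a,b))·σ⁴`, `K` the polynomial of `remainder349_norm_le` (there `≤ Kσ⁴τ`, here `τ ≤ 1`).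
[cite: Balaban1988Convergent, p.283] -/
theorem rhs349_norm_le (E2 : (Λ → T → V) →L[ℝ] (Λ → T → V) →L[ℝ] F)
    (E3 : (Λ → T → V) →L[ℝ] (Λ → T → V) →L[ℝ] (Λ → T → V) →L[ℝ] F)
    (E4 : (Λ → T → V) →L[ℝ] (Λ → T → V) →L[ℝ] (Λ → T → V) →L[ℝ] (Λ → T → V) →L[ℝ] F)
    {e₂ e₃ e₄ : ℝ} (he₂ : 0 ≤ e₂) (he₃ : 0 ≤ e₃) (he₄ : 0 ≤ e₄)
    (hE2 : ∀ u v, ‖E2 u v‖ ≤ e₂ * ‖u‖ * ‖v‖) (hE3 : ∀ u v w, ‖E3 u v w‖ ≤ e₃ * ‖u‖ * ‖v‖ * ‖w‖)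
    (hE4 : ∀ u v w x, ‖E4 u v w x‖ ≤ e₄ * ‖u‖ * ‖v‖ * ‖w‖ * ‖x‖)
    (br : V →ₗ[ℝ] V →ₗ[ℝ] V) {b : ℝ} (hb0 : 0 ≤ b) (hb : ∀ x y : V, ‖br x y‖ ≤ b * ‖x‖ * ‖y‖)
    (lam : T → V) (c ℓ B : Λ → T → V) {a σ τ : ℝ} (ha : 0 ≤ a) (hσ0 : 0 ≤ σ) (hσ1 : σ ≤ 1) (hστ : σ ≤ τ)
    (hτ1 : τ ≤ 1) (hc : ‖c‖ ≤ a * σ) (hlam : ‖lam‖ ≤ a * σ) (hℓ : ‖ℓ‖ ≤ a * σ ^ 2)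
    (hr : ‖B - c - ℓ‖ ≤ a * σ ^ 2 * τ) (S : F)
    (hS : S = (2 : ℝ)⁻¹ • E2 (ℓ + (2 : ℝ)⁻¹ • fun ν y => br (lam y) (c ν y)) (ℓ + (2 : ℝ)⁻¹ • fun ν y => br (lam y) (c ν y))
      + (E2 ℓ (B - c - ℓ) + (2 : ℝ)⁻¹ • E2 (B - c - ℓ) (B - c - ℓ)
        + (3 : ℝ)⁻¹ • E2 (B - c - ℓ) (fun ν y => br (lam y) (c ν y))
        + (3 : ℝ)⁻¹ • E2 (B - c) (fun ν y => br (lam y) ((B - c) ν y) - (2 : ℝ)⁻¹ • br ((B - c) ν y) (c ν y))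
        + (6 : ℝ)⁻¹ • E3 B B (B - c - ℓ)
        + (6 : ℝ)⁻¹ • E3 ℓ B (B - c)
        + (6 : ℝ)⁻¹ • E2 ℓ (fun ν y => br (lam y) ((B - c) ν y) - (2 : ℝ)⁻¹ • br ((B - c) ν y) (c ν y))
        + (6 : ℝ)⁻¹ • E2 (B - c) (fun ν y => br (lam y) (ℓ ν y) - (2 : ℝ)⁻¹ • br (ℓ ν y) (c ν y))
        + (8 : ℝ)⁻¹ • E2 (fun ν y => br (lam y) (c ν y))
            (fun ν y => br (lam y) ((B - c) ν y) - (2 : ℝ)⁻¹ • br ((B - c) ν y) (c ν y))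
        + (8 : ℝ)⁻¹ • E2 (B - c)
            (fun ν y => br (lam y) (br (lam y) (c ν y)) - (2 : ℝ)⁻¹ • br (br (lam y) (c ν y)) (c ν y))
        + (8 : ℝ)⁻¹ • E3 (fun ν y => br (lam y) (c ν y)) B (B - c)
        + (8 : ℝ)⁻¹ • E3 B B (fun ν y => br (lam y) ((B - c) ν y) - (2 : ℝ)⁻¹ • br ((B - c) ν y) (c ν y))
        - (48 : ℝ)⁻¹ • E2 B (fun ν y => br (B ν y) (br ((B - c) ν y) (c ν y)))
        + (24 : ℝ)⁻¹ • E4 B B B (B - c))) :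
    ‖S‖ ≤ ((2 : ℝ)⁻¹ * e₂ * (a + (2 : ℝ)⁻¹ * b * a ^ 2) ^ 2
        + ((3 / 2 : ℝ) * e₂ * a ^ 2 + (10 / 3 : ℝ) * e₂ * a ^ 3 * b + (9 / 8 : ℝ) * e₂ * a ^ 4 * b ^ 2
          + (5 / 2 : ℝ) * e₃ * a ^ 3 + (33 / 8 : ℝ) * e₃ * a ^ 4 * b + (9 / 4 : ℝ) * e₄ * a ^ 4)) * σ ^ 4 := by
  have hM := main349_norm_le E2 he₂ hE2 br hb0 hb lam c ℓ ha hσ0 hc hlam hℓ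
  have hR := remainder349_norm_le E2 E3 E4 he₂ he₃ he₄ hE2 hE3 hE4 br hb0 hb lam c ℓ B ha hσ0 hσ1 hστ hτ1 hc hlam
    hℓ hr
  set K : ℝ := (3 / 2 : ℝ) * e₂ * a ^ 2 + (10 / 3 : ℝ) * e₂ * a ^ 3 * b + (9 / 8 : ℝ) * e₂ * a ^ 4 * b ^ 2
          + (5 / 2 : ℝ) * e₃ * a ^ 3 + (33 / 8 : ℝ) * e₃ * a ^ 4 * b + (9 / 4 : ℝ) * e₄ * a ^ 4 with hK
  have hK0 : 0 ≤ K := by positivity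
  have hτ : K * σ ^ 4 * τ ≤ K * σ ^ 4 := mul_le_of_le_one_right (mul_nonneg hK0 (pow_nonneg hσ0 4)) hτ1
  rw [hS]
  refine (norm_add_le _ _).trans ?_
  calc _ ≤ (2 : ℝ)⁻¹ * e₂ * (a + (2 : ℝ)⁻¹ * b * a ^ 2) ^ 2 * σ ^ 4 + K * σ ^ 4 := add_le_add hM (hR.trans hτ)
    _ = _ := by ring

-- (the quadruply nested operator space over the iterated `Pi` type: one more level of pending instance synthesis)
set_option maxSynthPendingDepth 3 in
/-- **The left-hand side of (3.49) for 𝐑 is `O(σ⁴)`**: for abstract towers `R1, …, R4` under (I.4.14) (`h14`) and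
(I.4.15)₁,₂,₃ (`h1`, `h2`, `h3`, the shapes of `eq349_abstract`), bounded by `e₂, e₃, e₄`, with the field scalings of
p. 280: `‖R1 B + ½R2 B B + ⅙R3 B B B + (1/24)R4 B B B B‖ ≤ (½e₂(a + ½ba²)² + K)·σ⁴` — «we stop at the identity (3.49) …
all the terms on the right-hand side can be bounded by O(1)(LʲL⁻ⁿ)⁴[·]» with `σ = LʲL⁻ⁿ` and the size of the towers
still inside `e_n` (§4 pulls it out). [cite: Balaban1988Convergent, p.283] -/
theorem taylor4_norm_le (E1 : (Λ → T → V) →L[ℝ] F) (E2 : (Λ → T → V) →L[ℝ] (Λ → T → V) →L[ℝ] F)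
    (E3 : (Λ → T → V) →L[ℝ] (Λ → T → V) →L[ℝ] (Λ → T → V) →L[ℝ] F)
    (E4 : (Λ → T → V) →L[ℝ] (Λ → T → V) →L[ℝ] (Λ → T → V) →L[ℝ] (Λ → T → V) →L[ℝ] F)
    (hs2 : ∀ u v, E2 u v = E2 v u) (hs3l : ∀ u v w, E3 u v w = E3 v u w) (hs3r : ∀ u v w, E3 u v w = E3 u w v)
    {e₂ e₃ e₄ : ℝ} (he₂ : 0 ≤ e₂) (he₃ : 0 ≤ e₃) (he₄ : 0 ≤ e₄)
    (hE2 : ∀ u v, ‖E2 u v‖ ≤ e₂ * ‖u‖ * ‖v‖) (hE3 : ∀ u v w, ‖E3 u v w‖ ≤ e₃ * ‖u‖ * ‖v‖ * ‖w‖)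
    (hE4 : ∀ u v w x, ‖E4 u v w x‖ ≤ e₄ * ‖u‖ * ‖v‖ * ‖w‖ * ‖x‖)
    (br : V →ₗ[ℝ] V →ₗ[ℝ] V) {b : ℝ} (hb0 : 0 ≤ b) (hb : ∀ x y : V, ‖br x y‖ ≤ b * ‖x‖ * ‖y‖)
    (hself : ∀ a, br a a = 0) (lam : T → V) (c ℓ B : Λ → T → V)
    (h14 : ∀ u, E1 u = 0) (h1 : ∀ u, E2 u c = 0)
    (h2 : ∀ u v, E3 u v c - E2 u (fun ν y => br (lam y) (v ν y) - (2 : ℝ)⁻¹ • br (v ν y) (c ν y))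
      - E2 v (fun ν y => br (lam y) (u ν y) - (2 : ℝ)⁻¹ • br (u ν y) (c ν y)) = 0)
    (h3 : ∀ u₁ u₂ u₃, E4 u₁ u₂ u₃ c
      - E3 u₁ u₂ (fun ν y => br (lam y) (u₃ ν y) - (2 : ℝ)⁻¹ • br (u₃ ν y) (c ν y))
      - E3 u₁ u₃ (fun ν y => br (lam y) (u₂ ν y) - (2 : ℝ)⁻¹ • br (u₂ ν y) (c ν y))
      - E3 u₂ u₃ (fun ν y => br (lam y) (u₁ ν y) - (2 : ℝ)⁻¹ • br (u₁ ν y) (c ν y))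
      + E2 u₁ (fun ν y => (12 : ℝ)⁻¹ • (br (u₂ ν y) (br (u₃ ν y) (c ν y)) + br (u₃ ν y) (br (u₂ ν y) (c ν y))))
      + E2 u₂ (fun ν y => (12 : ℝ)⁻¹ • (br (u₁ ν y) (br (u₃ ν y) (c ν y)) + br (u₃ ν y) (br (u₁ ν y) (c ν y))))
      + E2 u₃ (fun ν y => (12 : ℝ)⁻¹ • (br (u₁ ν y) (br (u₂ ν y) (c ν y)) + br (u₂ ν y) (br (u₁ ν y) (c ν y))))
      = 0)
    {a σ τ : ℝ} (ha : 0 ≤ a) (hσ0 : 0 ≤ σ) (hσ1 : σ ≤ 1) (hστ : σ ≤ τ) (hτ1 : τ ≤ 1) (hc : ‖c‖ ≤ a * σ)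
    (hlam : ‖lam‖ ≤ a * σ) (hℓ : ‖ℓ‖ ≤ a * σ ^ 2) (hr : ‖B - c - ℓ‖ ≤ a * σ ^ 2 * τ) :
    ‖E1 B + (2 : ℝ)⁻¹ • E2 B B + (6 : ℝ)⁻¹ • E3 B B B + (24 : ℝ)⁻¹ • E4 B B B B‖
      ≤ ((2 : ℝ)⁻¹ * e₂ * (a + (2 : ℝ)⁻¹ * b * a ^ 2) ^ 2
        + ((3 / 2 : ℝ) * e₂ * a ^ 2 + (10 / 3 : ℝ) * e₂ * a ^ 3 * b + (9 / 8 : ℝ) * e₂ * a ^ 4 * b ^ 2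
          + (5 / 2 : ℝ) * e₃ * a ^ 3 + (33 / 8 : ℝ) * e₃ * a ^ 4 * b + (9 / 4 : ℝ) * e₄ * a ^ 4)) * σ ^ 4 :=
  rhs349_norm_le E2 E3 E4 he₂ he₃ he₄ hE2 hE3 hE4 br hb0 hb lam c ℓ B ha hσ0 hσ1 hστ hτ1 hc hlam hℓ hr _
    (eq349_abstract E1 E2 E3 E4 hs2 hs3l hs3r br hself lam c ℓ B h14 h1 h2 h3)

/-! ## §3. Adding the fifth-order Taylor remainder: the per-domain difference `D = 𝐑(X, U_k) − 𝐑(X, 1)` -/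

omit [NormedSpace ℝ V] in
/-- The size of the whole field from the sizes of its pieces: `B = B(z) + B(·,z) + r` with `‖B(z)‖ ≤ aσ`, `‖B(·,z)‖ ≤
aσ²`, `‖r‖ ≤ aσ²τ`, `σ, τ ≤ 1` gives `‖B‖ ≤ 3aσ` (cf. (I.4.16): the field itself is `O(σ)`). [folklore] -/
private theorem norm_field_le {c ℓ B : Λ → T → V} {a σ τ : ℝ} (ha : 0 ≤ a) (hσ0 : 0 ≤ σ) (hσ1 : σ ≤ 1)
    (hτ1 : τ ≤ 1) (hc : ‖c‖ ≤ a * σ) (hℓ : ‖ℓ‖ ≤ a * σ ^ 2) (hr : ‖B - c - ℓ‖ ≤ a * σ ^ 2 * τ) :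
    ‖B‖ ≤ 3 * a * σ := by
  have e : B = c + ℓ + (B - c - ℓ) := by abel
  have hσ2 : a * σ ^ 2 ≤ a * σ := by
    have : σ ^ 2 ≤ σ := by nlinarith
    exact mul_le_mul_of_nonneg_left this ha
  have h3 : a * σ ^ 2 * τ ≤ a * σ := (mul_le_of_le_one_right (by positivity) hτ1).trans hσ2
  calc ‖B‖ = ‖c + ℓ + (B - c - ℓ)‖ := by rw [← e]
    _ ≤ ‖c‖ + ‖ℓ‖ + ‖B - c - ℓ‖ := norm_add₃_le
    _ ≤ a * σ + a * σ + a * σ := add_le_add (add_le_add hc (hℓ.trans hσ2)) (hr.trans h3)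
    _ = 3 * a * σ := by ring

-- (the quadruply nested operator space over the iterated `Pi` type: one more level of pending instance synthesis)
set_option maxSynthPendingDepth 3 in
/-- **The per-domain bound for the difference `D`** (model: `D = 𝐑^{(j)}(X, U_k) − 𝐑^{(j)}(X, 1)`): if `D` agrees with the
fourth-order Taylor sum of the towers up to a fifth-order remainder `‖D − Σ_{n≤4}(1/n!)⟨R^{(n)},⊗ⁿB⟩‖ ≤ e₅‖B‖⁵` (print:
(I.3.34) with the bound (I.3.54); the tree's `…B14.Eq349Remainder.remainder349_norm_le`), then under the hypotheses of
`taylor4_norm_le`: `‖D‖ ≤ (½e₂(a + ½ba²)² + K + 243e₅a⁵)·σ⁴` (`σ⁵ ≤ σ⁴`). [cite: Balaban1988Convergent, p.283] -/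
theorem diff_norm_le (E1 : (Λ → T → V) →L[ℝ] F) (E2 : (Λ → T → V) →L[ℝ] (Λ → T → V) →L[ℝ] F)
    (E3 : (Λ → T → V) →L[ℝ] (Λ → T → V) →L[ℝ] (Λ → T → V) →L[ℝ] F)
    (E4 : (Λ → T → V) →L[ℝ] (Λ → T → V) →L[ℝ] (Λ → T → V) →L[ℝ] (Λ → T → V) →L[ℝ] F)
    (hs2 : ∀ u v, E2 u v = E2 v u) (hs3l : ∀ u v w, E3 u v w = E3 v u w) (hs3r : ∀ u v w, E3 u v w = E3 u w v)
    {e₂ e₃ e₄ e₅ : ℝ} (he₂ : 0 ≤ e₂) (he₃ : 0 ≤ e₃) (he₄ : 0 ≤ e₄) (he₅ : 0 ≤ e₅)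
    (hE2 : ∀ u v, ‖E2 u v‖ ≤ e₂ * ‖u‖ * ‖v‖) (hE3 : ∀ u v w, ‖E3 u v w‖ ≤ e₃ * ‖u‖ * ‖v‖ * ‖w‖)
    (hE4 : ∀ u v w x, ‖E4 u v w x‖ ≤ e₄ * ‖u‖ * ‖v‖ * ‖w‖ * ‖x‖)
    (br : V →ₗ[ℝ] V →ₗ[ℝ] V) {b : ℝ} (hb0 : 0 ≤ b) (hb : ∀ x y : V, ‖br x y‖ ≤ b * ‖x‖ * ‖y‖)
    (hself : ∀ a, br a a = 0) (lam : T → V) (c ℓ B : Λ → T → V)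
    (h14 : ∀ u, E1 u = 0) (h1 : ∀ u, E2 u c = 0)
    (h2 : ∀ u v, E3 u v c - E2 u (fun ν y => br (lam y) (v ν y) - (2 : ℝ)⁻¹ • br (v ν y) (c ν y))
      - E2 v (fun ν y => br (lam y) (u ν y) - (2 : ℝ)⁻¹ • br (u ν y) (c ν y)) = 0)
    (h3 : ∀ u₁ u₂ u₃, E4 u₁ u₂ u₃ c
      - E3 u₁ u₂ (fun ν y => br (lam y) (u₃ ν y) - (2 : ℝ)⁻¹ • br (u₃ ν y) (c ν y))
      - E3 u₁ u₃ (fun ν y => br (lam y) (u₂ ν y) - (2 : ℝ)⁻¹ • br (u₂ ν y) (c ν y))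
      - E3 u₂ u₃ (fun ν y => br (lam y) (u₁ ν y) - (2 : ℝ)⁻¹ • br (u₁ ν y) (c ν y))
      + E2 u₁ (fun ν y => (12 : ℝ)⁻¹ • (br (u₂ ν y) (br (u₃ ν y) (c ν y)) + br (u₃ ν y) (br (u₂ ν y) (c ν y))))
      + E2 u₂ (fun ν y => (12 : ℝ)⁻¹ • (br (u₁ ν y) (br (u₃ ν y) (c ν y)) + br (u₃ ν y) (br (u₁ ν y) (c ν y))))
      + E2 u₃ (fun ν y => (12 : ℝ)⁻¹ • (br (u₁ ν y) (br (u₂ ν y) (c ν y)) + br (u₂ ν y) (br (u₁ ν y) (c ν y))))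
      = 0)
    {a σ τ : ℝ} (ha : 0 ≤ a) (hσ0 : 0 ≤ σ) (hσ1 : σ ≤ 1) (hστ : σ ≤ τ) (hτ1 : τ ≤ 1) (hc : ‖c‖ ≤ a * σ)
    (hlam : ‖lam‖ ≤ a * σ) (hℓ : ‖ℓ‖ ≤ a * σ ^ 2) (hr : ‖B - c - ℓ‖ ≤ a * σ ^ 2 * τ) (D : F)
    (h5 : ‖D - (E1 B + (2 : ℝ)⁻¹ • E2 B B + (6 : ℝ)⁻¹ • E3 B B B + (24 : ℝ)⁻¹ • E4 B B B B)‖ ≤ e₅ * ‖B‖ ^ 5) :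
    ‖D‖ ≤ ((2 : ℝ)⁻¹ * e₂ * (a + (2 : ℝ)⁻¹ * b * a ^ 2) ^ 2
        + ((3 / 2 : ℝ) * e₂ * a ^ 2 + (10 / 3 : ℝ) * e₂ * a ^ 3 * b + (9 / 8 : ℝ) * e₂ * a ^ 4 * b ^ 2
          + (5 / 2 : ℝ) * e₃ * a ^ 3 + (33 / 8 : ℝ) * e₃ * a ^ 4 * b + (9 / 4 : ℝ) * e₄ * a ^ 4)
        + 243 * e₅ * a ^ 5) * σ ^ 4 := by
  set P : F := E1 B + (2 : ℝ)⁻¹ • E2 B B + (6 : ℝ)⁻¹ • E3 B B B + (24 : ℝ)⁻¹ • E4 B B B B with hP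
  have hT := taylor4_norm_le E1 E2 E3 E4 hs2 hs3l hs3r he₂ he₃ he₄ hE2 hE3 hE4 br hb0 hb hself lam c ℓ B h14 h1 h2
    h3 ha hσ0 hσ1 hστ hτ1 hc hlam hℓ hr
  have hB : ‖B‖ ≤ 3 * a * σ := norm_field_le ha hσ0 hσ1 hτ1 hc hℓ hr
  have hB5 : e₅ * ‖B‖ ^ 5 ≤ 243 * e₅ * a ^ 5 * σ ^ 4 := by
    have h1 : ‖B‖ ^ 5 ≤ (3 * a * σ) ^ 5 := by gcongr
    have hσ5 : σ ^ 5 ≤ σ ^ 4 := pow_le_pow_of_le_one hσ0 hσ1 (by norm_num)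
    calc e₅ * ‖B‖ ^ 5 ≤ e₅ * (3 * a * σ) ^ 5 := mul_le_mul_of_nonneg_left h1 he₅
      _ = 243 * e₅ * a ^ 5 * σ ^ 5 := by ring
      _ ≤ 243 * e₅ * a ^ 5 * σ ^ 4 := mul_le_mul_of_nonneg_left hσ5 (by positivity)
  have e : D = P + (D - P) := by abel
  calc ‖D‖ = ‖P + (D - P)‖ := by rw [← e]
    _ ≤ ‖P‖ + ‖D - P‖ := norm_add_le _ _
    _ ≤ _ + 243 * e₅ * a ^ 5 * σ ^ 4 := add_le_add hT (h5.trans hB5)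
    _ = _ := by ring

/-! ## §4. Print's form: the tower sizes proportional to `E = g_j^{κ₀}exp(−κd_j(X))` -/

-- (the quadruply nested operator space over the iterated `Pi` type: one more level of pending instance synthesis)
set_option maxSynthPendingDepth 3 in
/-- **«bounded by O(1)(LʲL⁻ⁿ)⁴g_j^{κ₀}exp(−κd_j(X))», VERBATIM with the O(1) explicit**: if the sizes of the towers and of
the fifth-order remainder are proportional to ONE number `E ≥ 0` — `e_n = k_n·E` for `n = 2, …, 5` (for Bałaban's
𝐑^{(j)}(X, ·): `E = g_j^{κ₀}exp(−κd_j(X))` by (2.31), the `k_n` the Cauchy factors of the analyticity space, model note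
M2) — then `‖D‖ ≤ C·σ⁴·E` with `C = ½k₂(a + ½ba²)² + K(k,a,b) + 243k₅a⁵`. [cite: Balaban1988Convergent, p.283] -/
theorem diff_norm_le_printed (E1 : (Λ → T → V) →L[ℝ] F) (E2 : (Λ → T → V) →L[ℝ] (Λ → T → V) →L[ℝ] F)
    (E3 : (Λ → T → V) →L[ℝ] (Λ → T → V) →L[ℝ] (Λ → T → V) →L[ℝ] F)
    (E4 : (Λ → T → V) →L[ℝ] (Λ → T → V) →L[ℝ] (Λ → T → V) →L[ℝ] (Λ → T → V) →L[ℝ] F)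
    (hs2 : ∀ u v, E2 u v = E2 v u) (hs3l : ∀ u v w, E3 u v w = E3 v u w) (hs3r : ∀ u v w, E3 u v w = E3 u w v)
    {E k₂ k₃ k₄ k₅ : ℝ} (hE : 0 ≤ E) (hk₂ : 0 ≤ k₂) (hk₃ : 0 ≤ k₃) (hk₄ : 0 ≤ k₄) (hk₅ : 0 ≤ k₅)
    (hE2 : ∀ u v, ‖E2 u v‖ ≤ k₂ * E * ‖u‖ * ‖v‖) (hE3 : ∀ u v w, ‖E3 u v w‖ ≤ k₃ * E * ‖u‖ * ‖v‖ * ‖w‖)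
    (hE4 : ∀ u v w x, ‖E4 u v w x‖ ≤ k₄ * E * ‖u‖ * ‖v‖ * ‖w‖ * ‖x‖)
    (br : V →ₗ[ℝ] V →ₗ[ℝ] V) {b : ℝ} (hb0 : 0 ≤ b) (hb : ∀ x y : V, ‖br x y‖ ≤ b * ‖x‖ * ‖y‖)
    (hself : ∀ a, br a a = 0) (lam : T → V) (c ℓ B : Λ → T → V)
    (h14 : ∀ u, E1 u = 0) (h1 : ∀ u, E2 u c = 0)
    (h2 : ∀ u v, E3 u v c - E2 u (fun ν y => br (lam y) (v ν y) - (2 : ℝ)⁻¹ • br (v ν y) (c ν y))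
      - E2 v (fun ν y => br (lam y) (u ν y) - (2 : ℝ)⁻¹ • br (u ν y) (c ν y)) = 0)
    (h3 : ∀ u₁ u₂ u₃, E4 u₁ u₂ u₃ c
      - E3 u₁ u₂ (fun ν y => br (lam y) (u₃ ν y) - (2 : ℝ)⁻¹ • br (u₃ ν y) (c ν y))
      - E3 u₁ u₃ (fun ν y => br (lam y) (u₂ ν y) - (2 : ℝ)⁻¹ • br (u₂ ν y) (c ν y))
      - E3 u₂ u₃ (fun ν y => br (lam y) (u₁ ν y) - (2 : ℝ)⁻¹ • br (u₁ ν y) (c ν y))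
      + E2 u₁ (fun ν y => (12 : ℝ)⁻¹ • (br (u₂ ν y) (br (u₃ ν y) (c ν y)) + br (u₃ ν y) (br (u₂ ν y) (c ν y))))
      + E2 u₂ (fun ν y => (12 : ℝ)⁻¹ • (br (u₁ ν y) (br (u₃ ν y) (c ν y)) + br (u₃ ν y) (br (u₁ ν y) (c ν y))))
      + E2 u₃ (fun ν y => (12 : ℝ)⁻¹ • (br (u₁ ν y) (br (u₂ ν y) (c ν y)) + br (u₂ ν y) (br (u₁ ν y) (c ν y))))
      = 0)
    {a σ τ : ℝ} (ha : 0 ≤ a) (hσ0 : 0 ≤ σ) (hσ1 : σ ≤ 1) (hστ : σ ≤ τ) (hτ1 : τ ≤ 1) (hc : ‖c‖ ≤ a * σ)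
    (hlam : ‖lam‖ ≤ a * σ) (hℓ : ‖ℓ‖ ≤ a * σ ^ 2) (hr : ‖B - c - ℓ‖ ≤ a * σ ^ 2 * τ) (D : F)
    (h5 : ‖D - (E1 B + (2 : ℝ)⁻¹ • E2 B B + (6 : ℝ)⁻¹ • E3 B B B + (24 : ℝ)⁻¹ • E4 B B B B)‖ ≤ k₅ * E * ‖B‖ ^ 5) :
    ‖D‖ ≤ ((2 : ℝ)⁻¹ * k₂ * (a + (2 : ℝ)⁻¹ * b * a ^ 2) ^ 2
        + ((3 / 2 : ℝ) * k₂ * a ^ 2 + (10 / 3 : ℝ) * k₂ * a ^ 3 * b + (9 / 8 : ℝ) * k₂ * a ^ 4 * b ^ 2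
          + (5 / 2 : ℝ) * k₃ * a ^ 3 + (33 / 8 : ℝ) * k₃ * a ^ 4 * b + (9 / 4 : ℝ) * k₄ * a ^ 4)
        + 243 * k₅ * a ^ 5) * σ ^ 4 * E := by
  have h := diff_norm_le E1 E2 E3 E4 hs2 hs3l hs3r (e₂ := k₂ * E) (e₃ := k₃ * E) (e₄ := k₄ * E) (e₅ := k₅ * E)
    (mul_nonneg hk₂ hE) (mul_nonneg hk₃ hE) (mul_nonneg hk₄ hE) (mul_nonneg hk₅ hE) hE2 hE3 hE4 br hb0 hb hself lam c
    ℓ B h14 h1 h2 h3 ha hσ0 hσ1 hστ hτ1 hc hlam hℓ hr D h5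
  calc ‖D‖ ≤ _ := h
    _ = _ := by ring

-- (the quadruply nested operator space over the iterated `Pi` type: one more level of pending instance synthesis)
set_option maxSynthPendingDepth 3 in
/-- The same with print's `E = g_j^{κ₀}exp(−κd_j(X))` substituted: `‖D‖ ≤ C·(LʲL⁻ⁿ)⁴·g_j^{κ₀}·exp(−κd_j(X))`, `g_j ≥ 0`.
[cite: Balaban1988Convergent, p.283] -/
theorem diff_norm_le_coupling (E1 : (Λ → T → V) →L[ℝ] F) (E2 : (Λ → T → V) →L[ℝ] (Λ → T → V) →L[ℝ] F)
    (E3 : (Λ → T → V) →L[ℝ] (Λ → T → V) →L[ℝ] (Λ → T → V) →L[ℝ] F)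
    (E4 : (Λ → T → V) →L[ℝ] (Λ → T → V) →L[ℝ] (Λ → T → V) →L[ℝ] (Λ → T → V) →L[ℝ] F)
    (hs2 : ∀ u v, E2 u v = E2 v u) (hs3l : ∀ u v w, E3 u v w = E3 v u w) (hs3r : ∀ u v w, E3 u v w = E3 u w v)
    {g κ dX k₂ k₃ k₄ k₅ : ℝ} {κ₀ : ℕ} (hg : 0 ≤ g) (hk₂ : 0 ≤ k₂) (hk₃ : 0 ≤ k₃) (hk₄ : 0 ≤ k₄) (hk₅ : 0 ≤ k₅)
    (hE2 : ∀ u v, ‖E2 u v‖ ≤ k₂ * (g ^ κ₀ * Real.exp (-κ * dX)) * ‖u‖ * ‖v‖)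
    (hE3 : ∀ u v w, ‖E3 u v w‖ ≤ k₃ * (g ^ κ₀ * Real.exp (-κ * dX)) * ‖u‖ * ‖v‖ * ‖w‖)
    (hE4 : ∀ u v w x, ‖E4 u v w x‖ ≤ k₄ * (g ^ κ₀ * Real.exp (-κ * dX)) * ‖u‖ * ‖v‖ * ‖w‖ * ‖x‖)
    (br : V →ₗ[ℝ] V →ₗ[ℝ] V) {b : ℝ} (hb0 : 0 ≤ b) (hb : ∀ x y : V, ‖br x y‖ ≤ b * ‖x‖ * ‖y‖)
    (hself : ∀ a, br a a = 0) (lam : T → V) (c ℓ B : Λ → T → V)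
    (h14 : ∀ u, E1 u = 0) (h1 : ∀ u, E2 u c = 0)
    (h2 : ∀ u v, E3 u v c - E2 u (fun ν y => br (lam y) (v ν y) - (2 : ℝ)⁻¹ • br (v ν y) (c ν y))
      - E2 v (fun ν y => br (lam y) (u ν y) - (2 : ℝ)⁻¹ • br (u ν y) (c ν y)) = 0)
    (h3 : ∀ u₁ u₂ u₃, E4 u₁ u₂ u₃ c
      - E3 u₁ u₂ (fun ν y => br (lam y) (u₃ ν y) - (2 : ℝ)⁻¹ • br (u₃ ν y) (c ν y))
      - E3 u₁ u₃ (fun ν y => br (lam y) (u₂ ν y) - (2 : ℝ)⁻¹ • br (u₂ ν y) (c ν y))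
      - E3 u₂ u₃ (fun ν y => br (lam y) (u₁ ν y) - (2 : ℝ)⁻¹ • br (u₁ ν y) (c ν y))
      + E2 u₁ (fun ν y => (12 : ℝ)⁻¹ • (br (u₂ ν y) (br (u₃ ν y) (c ν y)) + br (u₃ ν y) (br (u₂ ν y) (c ν y))))
      + E2 u₂ (fun ν y => (12 : ℝ)⁻¹ • (br (u₁ ν y) (br (u₃ ν y) (c ν y)) + br (u₃ ν y) (br (u₁ ν y) (c ν y))))
      + E2 u₃ (fun ν y => (12 : ℝ)⁻¹ • (br (u₁ ν y) (br (u₂ ν y) (c ν y)) + br (u₂ ν y) (br (u₁ ν y) (c ν y))))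
      = 0)
    {a σ τ : ℝ} (ha : 0 ≤ a) (hσ0 : 0 ≤ σ) (hσ1 : σ ≤ 1) (hστ : σ ≤ τ) (hτ1 : τ ≤ 1) (hc : ‖c‖ ≤ a * σ)
    (hlam : ‖lam‖ ≤ a * σ) (hℓ : ‖ℓ‖ ≤ a * σ ^ 2) (hr : ‖B - c - ℓ‖ ≤ a * σ ^ 2 * τ) (D : F)
    (h5 : ‖D - (E1 B + (2 : ℝ)⁻¹ • E2 B B + (6 : ℝ)⁻¹ • E3 B B B + (24 : ℝ)⁻¹ • E4 B B B B)‖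
      ≤ k₅ * (g ^ κ₀ * Real.exp (-κ * dX)) * ‖B‖ ^ 5) :
    ‖D‖ ≤ ((2 : ℝ)⁻¹ * k₂ * (a + (2 : ℝ)⁻¹ * b * a ^ 2) ^ 2
        + ((3 / 2 : ℝ) * k₂ * a ^ 2 + (10 / 3 : ℝ) * k₂ * a ^ 3 * b + (9 / 8 : ℝ) * k₂ * a ^ 4 * b ^ 2
          + (5 / 2 : ℝ) * k₃ * a ^ 3 + (33 / 8 : ℝ) * k₃ * a ^ 4 * b + (9 / 4 : ℝ) * k₄ * a ^ 4)
        + 243 * k₅ * a ^ 5) * σ ^ 4 * g ^ κ₀ * Real.exp (-κ * dX) := by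
  have hE : 0 ≤ g ^ κ₀ * Real.exp (-κ * dX) := mul_nonneg (pow_nonneg hg _) (Real.exp_pos _).le
  have h := diff_norm_le_printed E1 E2 E3 E4 hs2 hs3l hs3r hE hk₂ hk₃ hk₄ hk₅ hE2 hE3 hE4 br hb0 hb hself lam c ℓ B
    h14 h1 h2 h3 ha hσ0 hσ1 hστ hτ1 hc hlam hℓ hr D h5
  calc ‖D‖ ≤ _ := h
    _ = _ := by ring

end Towers

/-! ## §5. In the chart of a gauge-invariant functional with semisimple charge algebra: the WT hypotheses discharged -/

section Chart

open NormedSpace (exp)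
open Filter
open _root_.Topology

variable {𝔄 : Type*} [NormedRing 𝔄] [NormedAlgebra ℝ 𝔄] [CompleteSpace 𝔄] {Λ T : Type*} [Fintype Λ] [Fintype T]
  [AddCommGroup T] {V : Type*} [NormedAddCommGroup V] [NormedSpace ℝ V] {F : Type*} [NormedAddCommGroup F]
  [NormedSpace ℝ F]

-- (the quadruply nested operator space over the iterated `Pi` type: one more level of pending instance synthesis)
set_option maxSynthPendingDepth 3 in
/-- **The 𝐑-side bound in the chart `B ↦ 𝓡(exp ρB)`** of ANY functional `𝓡` (model: 𝐑^{(j)}(X, U_j(·))) that is `C⁴` at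
`1` and gauge invariant near `1` ((I.4.7), the inductive property (iii) of the 𝐑-terms, p. 260) with a finite-dimensional
SEMISIMPLE charge algebra `𝔤` («The group G is semisimple»): the Ward–Takahashi hypotheses of `taylor4_norm_le` are
DISCHARGED BY NAME (`…B14.Eq349WardReduction.eq349_chart_of_isSemisimple`), so that
`‖Df(0)B + ½D²f(0)(B,B) + ⅙D³f(0)(B,B,B) + (1/24)D⁴f(0)(B,B,B,B)‖ ≤ (½e₂(a + ½ba²)² + K)·σ⁴` under the operator bounds
`e₂, e₃, e₄` of `D²f(0), D³f(0), D⁴f(0)` (for 𝐑: Cauchy estimates from (2.31)), the Lie-bracket bound `b` and the field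
scalings. [cite: Balaban1988Convergent, p.283] -/
theorem taylor4_chart_norm_le_of_isSemisimple {𝔤 : Type*} [LieRing 𝔤] [LieAlgebra ℝ 𝔤] [FiniteDimensional ℝ 𝔤]
    [LieAlgebra.IsSemisimple ℝ 𝔤] (eV : V ≃ₗ[ℝ] 𝔤) {ℰ : (Λ → T → 𝔄) → F} (e : Λ → T) (ρ : V →L[ℝ] 𝔄)
    (hρ : ∀ a b : V, ρ (eV.symm ⁅eV a, eV b⁆) = ρ a * ρ b - ρ b * ρ a) (hℰ : ContDiffAt ℝ 4 ℰ 1)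
    (h47 : ∀ lam : T → V, ∀ᶠ W in 𝓝 (1 : Λ → T → 𝔄), ∀ᶠ t in 𝓝 (0 : ℝ),
      ℰ (fun ν x => exp (t • ρ (lam x)) * W ν x * exp (-(t • ρ (lam (x + e ν))))) = ℰ W)
    {e₂ e₃ e₄ : ℝ} (he₂ : 0 ≤ e₂) (he₃ : 0 ≤ e₃) (he₄ : 0 ≤ e₄)
    (hE2 : ∀ u v, ‖fderiv ℝ (fderiv ℝ (fun A : Λ → T → V => ℰ (fun ν y => exp (ρ (A ν y))))) 0 u v‖
      ≤ e₂ * ‖u‖ * ‖v‖)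
    (hE3 : ∀ u v w, ‖fderiv ℝ (fderiv ℝ (fderiv ℝ (fun A : Λ → T → V => ℰ (fun ν y => exp (ρ (A ν y)))))) 0 u v w‖
      ≤ e₃ * ‖u‖ * ‖v‖ * ‖w‖)
    (hE4 : ∀ u v w x, ‖fderiv ℝ (fderiv ℝ (fderiv ℝ (fderiv ℝ
      (fun A : Λ → T → V => ℰ (fun ν y => exp (ρ (A ν y))))))) 0 u v w x‖ ≤ e₄ * ‖u‖ * ‖v‖ * ‖w‖ * ‖x‖)
    {b : ℝ} (hb0 : 0 ≤ b) (hb : ∀ x y : V, ‖eV.symm ⁅eV x, eV y⁆‖ ≤ b * ‖x‖ * ‖y‖)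
    (lam : T → V) (c ℓ B : Λ → T → V) (hc : ∀ ν y, lam (y + e ν) - lam y = c ν y)
    {a σ τ : ℝ} (ha : 0 ≤ a) (hσ0 : 0 ≤ σ) (hσ1 : σ ≤ 1) (hστ : σ ≤ τ) (hτ1 : τ ≤ 1) (hcn : ‖c‖ ≤ a * σ)
    (hlam : ‖lam‖ ≤ a * σ) (hℓ : ‖ℓ‖ ≤ a * σ ^ 2) (hr : ‖B - c - ℓ‖ ≤ a * σ ^ 2 * τ) :
    ‖fderiv ℝ (fun A : Λ → T → V => ℰ (fun ν y => exp (ρ (A ν y)))) 0 B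
        + (2 : ℝ)⁻¹ • fderiv ℝ (fderiv ℝ (fun A : Λ → T → V => ℰ (fun ν y => exp (ρ (A ν y))))) 0 B B
        + (6 : ℝ)⁻¹ • fderiv ℝ (fderiv ℝ (fderiv ℝ (fun A : Λ → T → V => ℰ (fun ν y => exp (ρ (A ν y)))))) 0 B B B
        + (24 : ℝ)⁻¹ • fderiv ℝ (fderiv ℝ (fderiv ℝ (fderiv ℝ
            (fun A : Λ → T → V => ℰ (fun ν y => exp (ρ (A ν y))))))) 0 B B B B‖
      ≤ ((2 : ℝ)⁻¹ * e₂ * (a + (2 : ℝ)⁻¹ * b * a ^ 2) ^ 2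
        + ((3 / 2 : ℝ) * e₂ * a ^ 2 + (10 / 3 : ℝ) * e₂ * a ^ 3 * b + (9 / 8 : ℝ) * e₂ * a ^ 4 * b ^ 2
          + (5 / 2 : ℝ) * e₃ * a ^ 3 + (33 / 8 : ℝ) * e₃ * a ^ 4 * b + (9 / 4 : ℝ) * e₄ * a ^ 4)) * σ ^ 4 := by
  have h := eq349_chart_of_isSemisimple eV e ρ hρ hℰ h47 lam c ℓ B hc
  have key := rhs349_norm_le (fderiv ℝ (fderiv ℝ (fun A : Λ → T → V => ℰ (fun ν y => exp (ρ (A ν y))))) 0)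
    (fderiv ℝ (fderiv ℝ (fderiv ℝ (fun A : Λ → T → V => ℰ (fun ν y => exp (ρ (A ν y)))))) 0)
    (fderiv ℝ (fderiv ℝ (fderiv ℝ (fderiv ℝ (fun A : Λ → T → V => ℰ (fun ν y => exp (ρ (A ν y))))))) 0)
    he₂ he₃ he₄ hE2 hE3 hE4
    (LinearMap.mk₂ ℝ (fun a b => eV.symm ⁅eV a, eV b⁆) (fun _ _ _ => by simp) (fun _ _ _ => by simp)
      (fun _ _ _ => by simp) (fun _ _ _ => by simp)) hb0 (fun x y => by simpa only [LinearMap.mk₂_apply] using hb x y)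
    lam c ℓ B ha hσ0 hσ1 hστ hτ1 hcn hlam hℓ hr _ (by simpa only [LinearMap.mk₂_apply] using h)
  exact key

end Chart

/-! ## §6. «and this yields the inequality (2.44)»: the per-point term of `B14Sect3.Rep244` via (1.26) of [II] -/

section PerPoint

open Literature.MathematicalPhysics.QuantumFieldTheory.Balaban1983to89.B12TreeDecay

variable {Sy : LocDomainSys} (G : CubeSystem Sy)

/-- **p. 283 ⇒ the per-point term of (2.44)**: if every localization domain `X` above the cube of `z` contributes a
difference `r(X)` (model: `𝐑^{(j)}(X, U_k) − 𝐑^{(j)}(X, 1)`, a real number) obeying the per-domain bound of §4 with a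
COMMON constant `C` — `|r(X)| ≤ C·σ⁴·g^{κ₀}·exp(−κd_j(X))`, `σ = LʲL⁻ⁿ` —, then `|Σ_{X∋□_z} r(X)| ≤ C·K₀(c₀,Δ)·σ⁴·g^{κ₀}` for
`κ ≥ κ₀(c₀,Δ)`: the tree-decay summability (1.26) of [II] (`B14.Thm2Assembly.perPointR_of_domainBound`, itself on
`B12TreeDecay.ineq126_of_volumeLeaf` modulo its quoted leaf `VolumeLeaf`) — the per-point shape `(c′g_j^{κ₀})·(L^{j−n})⁴`
of `B14Sect3.Rep244` with `c′ = C·K₀`. [cite: Balaban1988Convergent, p.283] -/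
theorem perPointR_of_eq349 {Δ : ℕ} (hΔ : G.DegreeLE Δ) {c₀ : ℝ} (hV : G.VolumeLeaf c₀) {κ : ℝ}
    (hκ : kappa₀ c₀ Δ ≤ κ) {r : Sy.Dom → ℝ} {C σ g : ℝ} {κ₀' : ℕ} (hC : 0 ≤ C) (hσ : 0 ≤ σ) (hg : 0 ≤ g)
    (cz : G.Cube) (hr : ∀ X ∈ G.above cz, ‖r X‖ ≤ C * σ ^ 4 * g ^ κ₀' * Real.exp (-κ * Sy.dj X)) :
    |∑ X ∈ G.above cz, r X| ≤ C * K₀ c₀ Δ * σ ^ 4 * g ^ κ₀' :=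
  Thm2Assembly.perPointR_of_domainBound G hΔ hV hκ hC hσ hg cz fun X hX => by
    simpa only [Real.norm_eq_abs] using hr X hX

end PerPoint

end Literature.MathematicalPhysics.QuantumFieldTheory.Balaban1983to89.B14.Claim283RBound
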